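import Summits.ResolutionOfSingularities.ResolutionOfSingularities.Theorems.FrobeniusLadderFInjectiveMacaulayficationE8OffCentreRegular
import Mathlib.Algebra.MvPolynomial.PDeriv
import Mathlib.Algebra.CharP.Lemmas
import HarnessLib

/-!
# The `E₇⁰`-type point `X₂² + X₁X₀³ + X₁³` in characteristic `3` is regular off the origin

Support file for crux stmt-ResolutionOfSingularities-15315
(`FrobeniusLadder.FInjectiveMacaulayfication`, line `Sketch`, seat c5): stub
`stub_e7OffCentreRegular` of the CALIBRATION package — the second step of the characteristic-`3`
tower for `E₈⁰`, the characteristic-`3` / `E₇⁰` counterpart of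
`E8OffCentreRegular.stub_e8OffCentreRegular`.

Let `k` be a field of characteristic `3`, `S = k[X₀, X₁, X₂]` and `R' = S/(g)` with
`g = X₂² + X₁X₀³ + X₁³` — the strict transform of `E₈⁰` on the `y`-chart of the point blow-up,
an `E₇⁰`-type double point at the origin `𝔪' = (x̄, ȳ, z̄)`. The blow-up glue E6′ needs, as its
hypothesis `hoff`, that `R'` is regular at every prime `P` NOT containing `𝔪'`; this file proves
exactly that, by the Jacobian criterion in its regular direction at an arbitrary prime (tree
theorem `HypersurfaceRegular.stub_hypersurfaceRegularOfPderiv`, Matsumura Thm. 30.4 (ii)).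

What is proved:

* `pderiv_one_e7`, `pderiv_two_e7` — `∂g/∂X₁ = X₀³ + 3 X₁²` and `∂g/∂X₂ = 2 X₂` (over any
  commutative ring).
* `three_eq_zero_of_charP_three`, `two_ne_zero_of_charP_three` — `3 = 0` and `2 ≠ 0` in a field of
  characteristic `3` (`CharP.cast_eq_zero`, `CharP.cast_eq_zero_iff`).
* `stub_e7OffCentreRegular` — the registered form. With `P₀ = P ∩ S ∋ g`: if `X₂ ∉ P₀` then
  `∂g/∂X₂ = 2X₂ ∉ P₀` (`2` a unit), so `R'_P` is regular by the Jacobian criterion with `i = 2`;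
  else if `X₀ ∉ P₀` then `∂g/∂X₁ = X₀³ + 3X₁² = X₀³ ∉ P₀` (`P₀` prime), Jacobian criterion with
  `i = 1`; else `X₀, X₂ ∈ P₀` and `g ∈ P₀` give `X₁³ ∈ P₀`, hence `X₁ ∈ P₀`, so `𝔪' ≤ P` —
  excluded by hypothesis.

References: H. Matsumura, *Commutative Ring Theory*, Cambridge Stud. Adv. Math. 8, CUP 1986,
Thm. 30.4 (ii) [Matsumura1987] (through the imported Jacobian criterion); M. Artin, *Coverings of
the rational double points in characteristic `p`*, in: Complex Analysis and Algebraic Geometry,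
Iwanami Shoten 1977 [Artin1977] (the forms `E₈⁰`, `E₇⁰`, context only). The computation itself
is folklore.
-/

-- single-problem summit: the doubled namespace component is forced
set_option linter.dupNamespace false

noncomputable section

namespace Summit.ResolutionOfSingularities.ResolutionOfSingularities.Theorems.FInjectiveMacaulayfication.E7OffCentreRegular

open MvPolynomial

/-- **`∂g/∂X₁ = X₀³ + 3X₁²`** for `g = X₂² + X₁X₀³ + X₁³`, over any commutative ring:
`∂X₂/∂X₁ = ∂X₀/∂X₁ = 0`, `∂(X₁X₀³)/∂X₁ = X₀³`, `∂X₁³/∂X₁ = 3X₁²` (`MvPolynomial.pderiv_mul`,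
`pderiv_pow`, `pderiv_X_self`, `pderiv_X_of_ne`). [folklore] -/
theorem pderiv_one_e7 {A : Type*} [CommRing A] :
    pderiv 1 (X 2 ^ 2 + X 1 * X 0 ^ 3 + X 1 ^ 3 : MvPolynomial (Fin 3) A) =
      X 0 ^ 3 + C 3 * X 1 ^ 2 := by
  simp only [map_add, pderiv_mul, pderiv_pow, pderiv_X_self,
    pderiv_X_of_ne (show (2 : Fin 3) ≠ 1 by decide),
    pderiv_X_of_ne (show (0 : Fin 3) ≠ 1 by decide),
    mul_zero, zero_add, add_zero, mul_one, one_mul]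
  rw [map_ofNat]
  norm_num

/-- **`∂g/∂X₂ = 2X₂`** for `g = X₂² + X₁X₀³ + X₁³`, over any commutative ring:
`∂X₀/∂X₂ = ∂X₁/∂X₂ = 0`, `∂X₂²/∂X₂ = 2X₂` (`MvPolynomial.pderiv_mul`, `pderiv_pow`,
`pderiv_X_self`, `pderiv_X_of_ne`). [folklore] -/
theorem pderiv_two_e7 {A : Type*} [CommRing A] :
    pderiv 2 (X 2 ^ 2 + X 1 * X 0 ^ 3 + X 1 ^ 3 : MvPolynomial (Fin 3) A) = C 2 * X 2 := by
  simp only [map_add, pderiv_mul, pderiv_pow, pderiv_X_self,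
    pderiv_X_of_ne (show (0 : Fin 3) ≠ 2 by decide),
    pderiv_X_of_ne (show (1 : Fin 3) ≠ 2 by decide),
    mul_zero, zero_mul, add_zero, mul_one]
  rw [map_ofNat]
  norm_num

/-- **`3 = 0` in characteristic `3`** (`CharP.cast_eq_zero`). [folklore] -/
theorem three_eq_zero_of_charP_three {k : Type*} [Field k] [CharP k 3] : (3 : k) = 0 := by
  have h : ((3 : ℕ) : k) = 0 := CharP.cast_eq_zero k 3
  exact_mod_cast h

/-- **`2 ≠ 0` in characteristic `3`**: `(2 : k) = 0` would force `3 ∣ 2` (`CharP.cast_eq_zero_iff`).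
[folklore] -/
theorem two_ne_zero_of_charP_three {k : Type*} [Field k] [CharP k 3] : (2 : k) ≠ 0 := by
  intro h
  have h' : ((2 : ℕ) : k) = 0 := by exact_mod_cast h
  rw [CharP.cast_eq_zero_iff k 3 2] at h'
  omega

/-- **The `E₇⁰`-type point `g = X₂² + X₁X₀³ + X₁³` in characteristic `3` is regular off the origin**
(registered stub `stub_e7OffCentreRegular` of the calibration package): for a field `k` of
characteristic `3`, `S = k[X₀,X₁,X₂]`, `R' = S/(g)`, and a prime `P` of `R'` not containing
`𝔪' = (x̄, ȳ, z̄)`, the local ring `R'_P` is regular. Proof: let `P₀ = P ∩ S`, a prime containing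
`g`. If `X₂ ∉ P₀`, then `∂g/∂X₂ = 2X₂ ∉ P₀` (`2` is a unit,
`E8OffCentreRegular.mem_of_C_mul_mem`), and the Jacobian criterion
(`HypersurfaceRegular.stub_hypersurfaceRegularOfPderiv`, `i = 2`) applies; if `X₂ ∈ P₀` but
`X₀ ∉ P₀`, then `∂g/∂X₁ = X₀³ + 3X₁² = X₀³ ∉ P₀` (`3 = 0`, `P₀` prime) and the criterion applies
with `i = 1`; otherwise `X₀, X₂, g ∈ P₀` give `X₁³ = g - X₂² - X₁X₀³ ∈ P₀`, so `X₁ ∈ P₀` and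
`𝔪' ≤ P`, contradicting the hypothesis. [cite: Matsumura1987, Thm. 30.4 (ii)] for the Jacobian
criterion; the case analysis is folklore. -/
theorem stub_e7OffCentreRegular : ∀ (k : Type) [Field k] [CharP k 3] (g : MvPolynomial (Fin 3) k),
    g = MvPolynomial.X 2 ^ 2 + MvPolynomial.X 1 * MvPolynomial.X 0 ^ 3 + MvPolynomial.X 1 ^ 3 →
    ∀ (P : Ideal (MvPolynomial (Fin 3) k ⧸ Ideal.span {g})) [P.IsPrime],
      ¬ Ideal.span (Set.range fun j : Fin 3 => Ideal.Quotient.mk (Ideal.span {g}) (MvPolynomial.X j)) ≤ P →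
      IsRegularLocalRing (Localization.AtPrime P) := by
  intro k _ _ g hg P _ hP
  haveI hprime : (P.comap (Ideal.Quotient.mk (Ideal.span {g}))).IsPrime := Ideal.comap_isPrime _ _
  have hgP : g ∈ P.comap (Ideal.Quotient.mk (Ideal.span {g})) := by
    rw [Ideal.mem_comap, Ideal.Quotient.eq_zero_iff_mem.mpr (Ideal.mem_span_singleton_self g)]
    exact P.zero_mem
  by_cases h2 : (X 2 : MvPolynomial (Fin 3) k) ∈ P.comap (Ideal.Quotient.mk (Ideal.span {g}))
  · by_cases h0 : (X 0 : MvPolynomial (Fin 3) k) ∈ P.comap (Ideal.Quotient.mk (Ideal.span {g}))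
    · -- `X₀, X₂ ∈ P₀`: then `X₁ ∈ P₀` too, so `𝔪' ≤ P`, excluded
      exfalso
      refine hP ?_
      have h1 : (X 1 : MvPolynomial (Fin 3) k) ∈ P.comap (Ideal.Quotient.mk (Ideal.span {g})) := by
        refine hprime.mem_of_pow_mem 3 ?_
        have e : (X 1 ^ 3 : MvPolynomial (Fin 3) k) = g - X 2 * X 2 - X 1 * X 0 ^ 3 := by
          rw [hg]; ring
        rw [e]
        exact Ideal.sub_mem _ (Ideal.sub_mem _ hgP (Ideal.mul_mem_left _ _ h2))
          (Ideal.mul_mem_left _ _ (Ideal.pow_mem_of_mem _ h0 3 three_pos))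
      rw [Ideal.span_le, Set.range_subset_iff]
      intro j
      fin_cases j
      exacts [h0, h1, h2]
    · -- `X₂ ∈ P₀`, `X₀ ∉ P₀`: Jacobian criterion with `∂g/∂X₁ = X₀³ + 3X₁² = X₀³ ∉ P₀`
      refine HypersurfaceRegular.stub_hypersurfaceRegularOfPderiv k 3 g 1 P (fun hd => h0 ?_)
      have e : pderiv 1 g = X 0 ^ 3 := by
        rw [hg, pderiv_one_e7, three_eq_zero_of_charP_three, C_0, zero_mul, add_zero]
      rw [e] at hd
      exact hprime.mem_of_pow_mem 3 hd
  · -- `X₂ ∉ P₀`: Jacobian criterion with `∂g/∂X₂ = 2X₂ ∉ P₀`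
    refine HypersurfaceRegular.stub_hypersurfaceRegularOfPderiv k 3 g 2 P (fun hd => h2 ?_)
    have e : pderiv 2 g = C 2 * X 2 := by rw [hg]; exact pderiv_two_e7
    rw [e] at hd
    exact E8OffCentreRegular.mem_of_C_mul_mem _ two_ne_zero_of_charP_three hd

end Summit.ResolutionOfSingularities.ResolutionOfSingularities.Theorems.FInjectiveMacaulayfication.E7OffCentreRegular

end
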